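import Summits.AtomisticToContinuum.HydrodynamicLimit.Theorems.AntiMazurCoboundariesKineticFluxLdDecayFirstMomentBudget
import Summits.AtomisticToContinuum.HydrodynamicLimit.Theorems.AntiMazurCoboundariesKineticFluxLdDecayHTheoremObjectsE
import HarnessLib

/-!
# Second velocity moment budget for the crux line `h-theorem-dissipation-budget` (crux `KineticFluxLdDecay`,
# stmt-AtomisticToContinuum-10967) — registered stub `stub_secondMomentBudget` (objects part E)

In the frame of `Theorems/AntiMazurCoboundariesKineticFluxLdDecayHTheoremObjects.lean` (statement
`HTheorem.SecondMomentBudget` of `…HTheoremObjectsE.lean`): there is an absolute constant `c₂ ≥ 0` such that for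
constant profiles `a, θ > 0`, `σ ≤ 1/2`, every probability law `ν` with `KL(ν ‖ G_N) < ∞`, every time `t`, every
flow `Φ` and every `N`, the second velocity moment of the reduced one-body law `f_t` of `ν` is budgeted by the
`N`-body entropy per particle: `∫⁻ ‖w‖² df_t ≤ c₂ + 4·KL(ν ‖ G_N)/(N+1)`.

Proof (twin of `stub_firstMomentBudget`, Donsker–Varadhan with truncated velocity-normalised tests):

* `Z_∞ = ∫ e^{‖w‖²/4} dγ < ∞` (`γ` the standard Gaussian on `ℝ³`): through `map_pi_eq_stdGaussian` the integral
  factorises over the three coordinates, and in one dimension `e^{x²/4} · (2π)^{-1/2} e^{-x²/2}` is a Gaussian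
  density (`integrable_exp_neg_mul_sq`); `c₂ = 4 log Z_∞ ≥ 0`;
* `Z_n = ∫ e^{min(‖w‖², n)/4} dγ ∈ [1, Z_∞]` and the test `g_n(x, w) = min(‖w‖², n)/4 − log Z_n`: bounded,
  measurable, `∫ e^{g_n(x, ·)} dγ = 1`;
* the landed one-body Donsker–Varadhan test `integral_oneBodyLaw_le_klDiv` gives
  `(N+1)(∫ min(‖w‖², n)/4 df_t − log Z_n) ≤ KL(ν ‖ G_N)`, whence `∫ min(‖w‖², n) df_t ≤ 4 log Z_∞ + 4 KL/(N+1)`;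
* monotone convergence in `n` (`lintegral_iSup`, `‖w‖ₑ² = ⨆ₙ ofReal (min(‖w‖², n))`).

`Z_∞` and `Z_n` are written out as the explicit integrals throughout (this file introduces no definitions).

Reference: C. Kipnis, C. Landim, *Scaling Limits of Interacting Particle Systems* (1999), App. 1 §8
(entropy inequality).
-/

noncomputable section

open MeasureTheory ProbabilityTheory Set Filter InformationTheory
open scoped ENNReal

namespace Summit.AtomisticToContinuum.HydrodynamicLimit.Theorems.HTheorem

open Literature.MathematicalPhysics.KineticTheory (T3 V3)

namespace SecondMoment

/-! ### Gaussian exponential moments of the (truncated) squared speed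

`Z_∞ = ∫ e^{‖w‖²/4} dγ` and `Z_n = ∫ e^{min(‖w‖², n)/4} dγ`, `γ = stdGaussian ℝ³`. -/

/-- One dimension: `x ↦ e^{x²/4}` is integrable under the standard real Gaussian
(`e^{x²/4} (2π)^{-1/2} e^{-x²/2} = (2π)^{-1/2} e^{-x²/4}`). -/
theorem integrable_exp_sq_real :
    Integrable (fun x : ℝ => Real.exp (x ^ 2 / 4)) (gaussianReal 0 1) := by
  rw [gaussianReal_of_var_ne_zero 0 one_ne_zero,
    integrable_withDensity_iff_integrable_smul' (measurable_gaussianPDF 0 1)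
      (ae_of_all _ fun _ => gaussianPDF_lt_top)]
  have h : (fun x : ℝ => (gaussianPDF 0 1 x).toReal • Real.exp (x ^ 2 / 4)) =
      fun x => (√(2 * Real.pi * ((1 : NNReal) : ℝ)))⁻¹ * Real.exp (-(1 / 4) * x ^ 2) := by
    ext x
    rw [toReal_gaussianPDF, gaussianPDFReal, smul_eq_mul, mul_assoc, ← Real.exp_add]
    congr 2
    push_cast
    ring
  rw [h]
  exact (integrable_exp_neg_mul_sq (by norm_num : (0 : ℝ) < 1 / 4)).const_mul _

/-- `w ↦ e^{‖w‖²/4}` is `γ`-integrable: `Z_∞ < ∞` (product structure of the standard Gaussian on `ℝ³`). -/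
theorem integrable_exp_sq : Integrable (fun w : V3 => Real.exp (‖w‖ ^ 2 / 4)) (stdGaussian V3) := by
  rw [← map_pi_eq_stdGaussian,
    integrable_map_measure (by fun_prop : AEStronglyMeasurable (fun w : V3 => Real.exp (‖w‖ ^ 2 / 4)) _)
      (by fun_prop : AEMeasurable (WithLp.toLp 2 : (Fin 3 → ℝ) → V3) _)]
  have h : (fun w : V3 => Real.exp (‖w‖ ^ 2 / 4)) ∘ (WithLp.toLp 2 : (Fin 3 → ℝ) → V3) =
      fun x : Fin 3 → ℝ => ∏ i, Real.exp (x i ^ 2 / 4) := by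
    ext x
    rw [Function.comp_apply, EuclideanSpace.real_norm_sq_eq, Finset.sum_div, Real.exp_sum]
  rw [h]
  exact Integrable.fintype_prod fun _ => integrable_exp_sq_real

/-- `w ↦ e^{min(‖w‖², n)/4}` is `γ`-integrable (dominated by `e^{‖w‖²/4}`). -/
theorem integrable_exp_min (n : ℕ) :
    Integrable (fun w : V3 => Real.exp (min (‖w‖ ^ 2) (n : ℝ) / 4)) (stdGaussian V3) := by
  refine integrable_exp_sq.mono'
    (by fun_prop : Continuous fun w : V3 => Real.exp (min (‖w‖ ^ 2) (n : ℝ) / 4)).aestronglyMeasurable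
    (ae_of_all _ fun w => ?_)
  rw [Real.norm_eq_abs, abs_of_pos (Real.exp_pos _)]
  exact Real.exp_le_exp.2 (div_le_div_of_nonneg_right (min_le_left _ _) (by norm_num))

/-- `1 ≤ Z_n` (`γ` is a probability measure and `e^{min(‖w‖², n)/4} ≥ 1`). -/
theorem one_le_zTrunc (n : ℕ) : 1 ≤ ∫ w, Real.exp (min (‖w‖ ^ 2) (n : ℝ) / 4) ∂(stdGaussian V3) := by
  have h : ∫ _w, (1 : ℝ) ∂(stdGaussian V3) ≤ ∫ w, Real.exp (min (‖w‖ ^ 2) (n : ℝ) / 4) ∂(stdGaussian V3) :=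
    integral_mono (integrable_const 1) (integrable_exp_min n) fun w =>
      Real.one_le_exp (div_nonneg (le_min (sq_nonneg _) (Nat.cast_nonneg _)) (by norm_num))
  simpa using h

/-- `Z_n ≤ Z_∞`. -/
theorem zTrunc_le_zInf (n : ℕ) :
    ∫ w, Real.exp (min (‖w‖ ^ 2) (n : ℝ) / 4) ∂(stdGaussian V3) ≤
      ∫ w, Real.exp (‖w‖ ^ 2 / 4) ∂(stdGaussian V3) :=
  integral_mono (integrable_exp_min n) integrable_exp_sq fun _ =>
    Real.exp_le_exp.2 (div_le_div_of_nonneg_right (min_le_left _ _) (by norm_num))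

/-- `1 ≤ Z_∞`. -/
theorem one_le_zInf : 1 ≤ ∫ w, Real.exp (‖w‖ ^ 2 / 4) ∂(stdGaussian V3) :=
  (one_le_zTrunc 0).trans (zTrunc_le_zInf 0)

/-- `0 ≤ log Z_n ≤ log Z_∞`. -/
theorem log_zTrunc_mem (n : ℕ) :
    0 ≤ Real.log (∫ w, Real.exp (min (‖w‖ ^ 2) (n : ℝ) / 4) ∂(stdGaussian V3)) ∧
      Real.log (∫ w, Real.exp (min (‖w‖ ^ 2) (n : ℝ) / 4) ∂(stdGaussian V3)) ≤
        Real.log (∫ w, Real.exp (‖w‖ ^ 2 / 4) ∂(stdGaussian V3)) :=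
  ⟨Real.log_nonneg (one_le_zTrunc n),
    Real.log_le_log (by linarith [one_le_zTrunc n]) (zTrunc_le_zInf n)⟩

/-! ### The truncated velocity-normalised one-body tests `g_n(x, w) = min(‖w‖², n)/4 − log Z_n` -/

/-- `g_n` is measurable. -/
theorem measurable_test (n : ℕ) :
    Measurable fun p : T3 × V3 =>
      min (‖p.2‖ ^ 2) (n : ℝ) / 4 -
        Real.log (∫ w, Real.exp (min (‖w‖ ^ 2) (n : ℝ) / 4) ∂(stdGaussian V3)) := by
  fun_prop

/-- `|g_n| ≤ n/4 + log Z_∞`. -/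
theorem abs_test_le (n : ℕ) (p : T3 × V3) :
    |min (‖p.2‖ ^ 2) (n : ℝ) / 4 -
        Real.log (∫ w, Real.exp (min (‖w‖ ^ 2) (n : ℝ) / 4) ∂(stdGaussian V3))| ≤
      n / 4 + Real.log (∫ w, Real.exp (‖w‖ ^ 2 / 4) ∂(stdGaussian V3)) := by
  obtain ⟨h0, h1⟩ := log_zTrunc_mem n
  have h2 : 0 ≤ min (‖p.2‖ ^ 2) (n : ℝ) := le_min (sq_nonneg _) (Nat.cast_nonneg _)
  have h3 : min (‖p.2‖ ^ 2) (n : ℝ) ≤ n := min_le_right _ _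
  rw [abs_le]
  constructor <;> linarith

/-- `g_n` is velocity-normalised: `∫ e^{g_n(x, w)} γ(dw) = Z_n / Z_n = 1`. -/
theorem integral_exp_test (n : ℕ) :
    ∫ w, Real.exp (min (‖w‖ ^ 2) (n : ℝ) / 4 -
        Real.log (∫ w', Real.exp (min (‖w'‖ ^ 2) (n : ℝ) / 4) ∂(stdGaussian V3)))
      ∂(stdGaussian V3) = 1 := by
  have hZ : 0 < ∫ w', Real.exp (min (‖w'‖ ^ 2) (n : ℝ) / 4) ∂(stdGaussian V3) := by
    linarith [one_le_zTrunc n]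
  simp_rw [Real.exp_sub, Real.exp_log hZ, integral_div]
  exact div_self hZ.ne'

/-- `min(‖w‖², n)` is integrable against every finite one-body law. -/
theorem integrable_min_sq (n : ℕ) (μ : Measure (T3 × V3)) [IsFiniteMeasure μ] :
    Integrable (fun p : T3 × V3 => min (‖p.2‖ ^ 2) (n : ℝ)) μ :=
  Integrable.of_bound
    (by fun_prop : Measurable fun p : T3 × V3 => min (‖p.2‖ ^ 2) (n : ℝ)).aestronglyMeasurable n
    (ae_of_all _ fun p => by
      rw [Real.norm_eq_abs, abs_of_nonneg (le_min (sq_nonneg _) (Nat.cast_nonneg _))]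
      exact min_le_right _ _)

/-- **Truncated second moment budget**: `∫ min(‖w‖², n) df_t ≤ 4 log Z_∞ + 4 KL(ν ‖ G_N)/(N+1)` for every `n`
(the one-body Donsker–Varadhan test `integral_oneBodyLaw_le_klDiv` with `g_n`). -/
theorem integral_min_sq_le {σ a θ : ℝ} (ha : 0 < a) (hθ : 0 < θ) (hσ : σ ≤ 1 / 2) (u₀ : V3)
    (N : ℕ) (Φ : Flow σ N) (ν : Measure (Phase N)) [IsProbabilityMeasure ν]
    (hfin : klDiv ν (gibbs σ a θ u₀ N Φ) ≠ ⊤) (t : ℝ) (n : ℕ) :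
    ∫ p, min (‖p.2‖ ^ 2) (n : ℝ) ∂(oneBodyLaw θ u₀ Φ ν t) ≤
      4 * Real.log (∫ w, Real.exp (‖w‖ ^ 2 / 4) ∂(stdGaussian V3)) +
        4 * (klDiv ν (gibbs σ a θ u₀ N Φ)).toReal / ((N + 1 : ℕ) : ℝ) := by
  haveI := isProbabilityMeasure_oneBodyLaw (Nat.succ_ne_zero N) θ u₀ Φ ν t
  have hn : (0 : ℝ) < ((N + 1 : ℕ) : ℝ) := Nat.cast_pos.2 (Nat.succ_pos N)
  have h := integral_oneBodyLaw_le_klDiv ha hθ hσ u₀ N Φ ν hfin t (measurable_test n) (abs_test_le n)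
    fun _ => integral_exp_test n
  rw [integral_sub ((integrable_min_sq n _).div_const _) (integrable_const _), integral_const,
    probReal_univ, one_smul, integral_div] at h
  have h' : (∫ p, min (‖p.2‖ ^ 2) (n : ℝ) ∂(oneBodyLaw θ u₀ Φ ν t)) / 4 -
      Real.log (∫ w, Real.exp (min (‖w‖ ^ 2) (n : ℝ) / 4) ∂(stdGaussian V3)) ≤
        (klDiv ν (gibbs σ a θ u₀ N Φ)).toReal / ((N + 1 : ℕ) : ℝ) := by
    rw [le_div_iff₀ hn, mul_comm]
    exact h
  have h'' : 4 * (klDiv ν (gibbs σ a θ u₀ N Φ)).toReal / ((N + 1 : ℕ) : ℝ) =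
      4 * ((klDiv ν (gibbs σ a θ u₀ N Φ)).toReal / ((N + 1 : ℕ) : ℝ)) := mul_div_assoc _ _ _
  rw [h'']
  linarith [(log_zTrunc_mem n).2]

/-- Monotone truncation of the squared extended norm: `‖w‖ₑ² = ⨆ₙ ofReal (min(‖w‖², n))`. -/
theorem enorm_sq_eq_iSup_min (w : V3) :
    ‖w‖ₑ ^ 2 = ⨆ n : ℕ, ENNReal.ofReal (min (‖w‖ ^ 2) (n : ℝ)) := by
  rw [← ofReal_norm, ← ENNReal.ofReal_pow (norm_nonneg _)]
  refine le_antisymm ?_ (iSup_le fun n => ENNReal.ofReal_le_ofReal (min_le_left _ _))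
  obtain ⟨n, hn⟩ := exists_nat_ge (‖w‖ ^ 2)
  refine le_iSup_of_le n ?_
  rw [min_eq_left hn]

/-- **Second moment budget with the explicit constant `c₂ = 4 log Z_∞`**:
`∫⁻ ‖w‖² df_t ≤ ofReal (4 log Z_∞ + 4 KL(ν ‖ G_N)/(N+1))` (monotone convergence over the truncations). -/
theorem lintegral_enorm_sq_le {σ a θ : ℝ} (ha : 0 < a) (hθ : 0 < θ) (hσ : σ ≤ 1 / 2) (u₀ : V3)
    (N : ℕ) (Φ : Flow σ N) (ν : Measure (Phase N)) [IsProbabilityMeasure ν]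
    (hfin : klDiv ν (gibbs σ a θ u₀ N Φ) ≠ ⊤) (t : ℝ) :
    ∫⁻ y, ‖y.2‖ₑ ^ 2 ∂(oneBodyLaw θ u₀ Φ ν t) ≤
      ENNReal.ofReal (4 * Real.log (∫ w, Real.exp (‖w‖ ^ 2 / 4) ∂(stdGaussian V3)) +
        4 * (klDiv ν (gibbs σ a θ u₀ N Φ)).toReal / ((N + 1 : ℕ) : ℝ)) := by
  haveI := isProbabilityMeasure_oneBodyLaw (Nat.succ_ne_zero N) θ u₀ Φ ν t
  have hmeas : ∀ n : ℕ, Measurable fun y : T3 × V3 => ENNReal.ofReal (min (‖y.2‖ ^ 2) (n : ℝ)) :=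
    fun n => by fun_prop
  have hmono : Monotone fun (n : ℕ) (y : T3 × V3) => ENNReal.ofReal (min (‖y.2‖ ^ 2) (n : ℝ)) := by
    intro m n hmn y
    exact ENNReal.ofReal_le_ofReal (min_le_min_left _ (Nat.cast_le.2 hmn))
  calc ∫⁻ y, ‖y.2‖ₑ ^ 2 ∂(oneBodyLaw θ u₀ Φ ν t)
      = ∫⁻ y, ⨆ n : ℕ, ENNReal.ofReal (min (‖y.2‖ ^ 2) (n : ℝ)) ∂(oneBodyLaw θ u₀ Φ ν t) :=
        lintegral_congr fun y => enorm_sq_eq_iSup_min y.2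
    _ = ⨆ n : ℕ, ∫⁻ y, ENNReal.ofReal (min (‖y.2‖ ^ 2) (n : ℝ)) ∂(oneBodyLaw θ u₀ Φ ν t) :=
        lintegral_iSup hmeas hmono
    _ ≤ _ := iSup_le fun n => ?_
  rw [← ofReal_integral_eq_lintegral_ofReal (integrable_min_sq n _)
    (ae_of_all _ fun y => le_min (sq_nonneg _) (Nat.cast_nonneg _))]
  exact ENNReal.ofReal_le_ofReal (integral_min_sq_le ha hθ hσ u₀ N Φ ν hfin t n)

end SecondMoment

/-! ### The registered stub -/

/-- **Second moment budget, explicit form**: with `c₂ = 4 log ∫ e^{‖w‖²/4} dγ ≥ 0`, for constant profiles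
`a, θ > 0`, `σ ≤ 1/2`, every probability law `ν` with `KL(ν ‖ G_N) < ∞`, every time, flow and `N`:
`∫⁻ ‖w‖² df_t ≤ ofReal (c₂ + 4 KL(ν ‖ G_N)/(N+1))`. -/
theorem secondMomentBudget_explicit :
    ∃ c₂ : ℝ, 0 ≤ c₂ ∧ ∀ (σ a θ : ℝ) (u₀ : V3) (N : ℕ) (Φ : Flow σ N) (ν : Measure (Phase N)),
      IsProbabilityMeasure ν → 0 < a → 0 < θ → σ ≤ 1 / 2 →
      klDiv ν (gibbs σ a θ u₀ N Φ) ≠ ⊤ → ∀ t : ℝ,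
        ∫⁻ y, ‖y.2‖ₑ ^ 2 ∂(oneBodyLaw θ u₀ Φ ν t) ≤
          ENNReal.ofReal (c₂ + 4 * (klDiv ν (gibbs σ a θ u₀ N Φ)).toReal / ((N + 1 : ℕ) : ℝ)) :=
  ⟨4 * Real.log (∫ w, Real.exp (‖w‖ ^ 2 / 4) ∂(stdGaussian V3)),
    mul_nonneg (by norm_num) (Real.log_nonneg SecondMoment.one_le_zInf),
    fun _σ _a _θ u₀ N Φ ν _ ha hθ hσ hfin t =>
      SecondMoment.lintegral_enorm_sq_le ha hθ hσ u₀ N Φ ν hfin t⟩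

/-- **Second moment budget** (registered stub `stub_secondMomentBudget` of the line
`h-theorem-dissipation-budget`, objects part E): finite relative entropy w.r.t. the Gibbs law budgets the second
velocity moment of the reduced one-body law, uniformly in the time, the flow and `N`:
`∫⁻ ‖w‖² df_t ≤ c₂ + 4 KL(ν ‖ G_N)/(N+1)` with the absolute constant `c₂ = 4 log ∫ e^{‖w‖²/4} dγ`. -/
theorem stub_secondMomentBudget : SecondMomentBudget := secondMomentBudget_explicit

end Summit.AtomisticToContinuum.HydrodynamicLimit.Theorems.HTheorem

end
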